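/-
Copyright: harness tree, Literature layer (sorry-free). b2b-lace packet, carver (gen 45), node KU-SEP, leaf
KU-SEP-SEED, slice K1: the LITERAL-READY bound of the row-truncation / coefficient-rounding error `truncErrT`
of a twisted seed certificate. d-generic; number-free; what-if / input-certification lane device; no statement at
any fixed dimension.
-/
import Literature.Probability.FitznerVanDerHofstad2017.SrwTwistSeedCertRow
import Literature.Probability.FitznerVanDerHofstad2017.SrwIntegralJFarField
import Literature.Analysis.FunctionSpaces.BesselJLiteralCert
import HarnessLib

/-!
# Twisted SEEDCERT: bounding the truncation error `truncErrT` by three scalars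

`TwCert.srwTwist_mem_of_checkT` (module `SrwTwistSeedCertRow`) brackets the twisted axis seed
`Tw_{n+1}(m e_i; β) = srwTwist D (n+1) 1 (m e_i) β` by the certificate's literal interval widened by
`E = TwCert.truncErrT c D n β M`, the explicit error of `SrwTwistTruncationSeeds.abs_srwTwist_sub_rowObj_le`:

`E = Σ_{k<D} C(D,k+1) (2δ)^{k+1} I_{n+1,0}(x_k) + ((α' + η)^D − α'^D)/(2π)^D · I_{n+1,0}(0)`,

`δ = Σ_{l ≥ 0} |J_{l+J+1}(β/D)|` (Bessel-`J` order tail), `α' = Σ_{j ≤ J} ε_j ‖c_j‖`, `c_j = 2π iʲ Q_j/qden`,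
`η = Σ_{j ≤ J} ε_j ‖2π iʲ J_j(β/D) − c_j‖`, `x_k = (J+1)M (e_0 + … + e_k)` (`ε_0 = 1`, `ε_j = 2`).
This module reduces `E` to THREE SCALAR INPUTS a consumer can supply as literals:

* `TwCert.absMassQ c = Σ_j ε_j |Q_j| / qden ∈ ℚ` and `Σ_j ε_j ‖c_j‖ = 2π · absMassQ` (`sum_weight_norm_cT`);
* **`TwCert.truncErrT_le`**: if `δ ≤ δ̄`, `|Q_j/qden − J_j(β/D)| ≤ e` for `j ≤ J`, and every plain seed
  `I_{n+1,0}(x_k)`, `I_{n+1,0}(0)` is `≤ I`, then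
  `E ≤ (((1 + 2δ̄)^D − 1) + ((A + (2J+1) e)^D − A^D)) · I`, `A = absMassQ`
  (binomial identity `Σ_{k<D} C(D,k+1) x^{k+1} = (1+x)^D − 1`; `η ≤ (2J+1)·2π·e` from
  `JLit.norm_coeff_sub_coeff_le`; the powers of `2π` cancel exactly);
* `TwCert.truncErrT_zero_le` — the case `M = 0` (all `x_k = 0`; one seed bound `I_{n+1,0}(0) ≤ I`);
* `TwCert.truncErrQ` — the same bound as a rational function of rational inputs, with `cast_truncErrQ` and
  `TwCert.truncErrT_zero_le_cast` (`E ≤ ((truncErrQ c D δ̄ e I : ℚ) : ℝ)`), the shape a kernel-decided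
  consumer inequality uses.

The three inputs have tree sources: `δ̄` from `tsum_abs_besselJ_tail_le_of_abs_le_one`
(`SrwTwistRowOrderBall`, `|β/D| ≤ 1`), `e` from a decided `JLit.Cert` (`BesselJLiteralCert`), `I` from the
decided I-tables (`I_{n+1,0}(0)` literals). Everything is PROVED (standard axioms), generic in the
dimension and number-free; two rational bookkeeping definitions (`absMassQ`, `truncErrQ`), no instance, no
named fact. Epistemic status / lane: what-if / input-certification SUPPORT; nothing here is a certificate; no
statement at a specific dimension.

## References
* R. Fitzner, R. van der Hofstad, *Generalized approach to the non-backtracking lace expansion*,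
  PTRF 169 (2017) 1041–1119 (arXiv:1506.07969), (3.34)–(3.36) p. 1071, §5.1.1 (5.2)–(5.5) pp. 1089–1090
  (the Bessel-row evaluation of the SRW integrals of the notebook `SRW.nb` §1). [FitznerVanDerHofstad2016NoBLE]
* NIST DLMF §10.2.2, §10.14.4, §10.35.2. [DLMF]
[cite: FitznerVanDerHofstad2016NoBLE, §5.1.1 (5.2)–(5.5) pp. 1089–1090]
-/

set_option Elab.async false

namespace Literature.Probability.FitznerVanDerHofstad2017.SeedCert

open Real MeasureTheory Set Finset
open Literature.Probability.LatticeModels (besselI)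
open Literature.Analysis.FunctionSpaces (besselJ)
open scoped Nat

/-- `Σ_{j ≤ K} ε_j = 2K + 1` (`ε_0 = 1`, `ε_j = 2`). [cite: FitznerVanDerHofstad2016NoBLE, §5.1.1 (5.2)–(5.5) pp. 1089–1090] -/
theorem sum_rowWeight_eq (K : ℕ) :
    ∑ j ∈ Finset.range (K + 1), (if j = 0 then (1 : ℝ) else 2) = 2 * K + 1 := by
  induction K with
  | zero => simp
  | succ K ih =>
    rw [Finset.sum_range_succ, ih, if_neg (Nat.succ_ne_zero K)]
    push_cast; ring

/-- `Σ_{k<D} C(D,k+1) x^{k+1} = (1+x)^D − 1`. [cite: FitznerVanDerHofstad2016NoBLE, §5.1.1 (5.2)–(5.5) pp. 1089–1090] -/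
theorem sum_choose_succ_mul_pow_succ (D : ℕ) (x : ℝ) :
    ∑ k ∈ Finset.range D, (D.choose (k + 1) : ℝ) * x ^ (k + 1) = (1 + x) ^ D - 1 := by
  have h := add_pow x 1 D
  rw [Finset.sum_range_succ'] at h
  simp only [one_pow, mul_one, pow_zero, Nat.choose_zero_right, Nat.cast_one] at h
  have h' : ∑ k ∈ Finset.range D, (D.choose (k + 1) : ℝ) * x ^ (k + 1)
      = ∑ k ∈ Finset.range D, x ^ (k + 1) * (D.choose (k + 1) : ℝ) :=
    Finset.sum_congr rfl fun k _ => mul_comm _ _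
  rw [h', add_comm (1 : ℝ) x, h]
  ring

namespace TwCert

variable (c : TwCert) (D : ℕ)

/-- The absolute row mass `A = Σ_{j ≤ J} ε_j |Q_j| / qden` of the certificate's literal weights (a rational).
[cite: FitznerVanDerHofstad2016NoBLE, §5.1.1 (5.2)–(5.5) pp. 1089–1090] -/
def absMassQ : ℚ :=
  |(c.Q 0 : ℚ)| / (c.qden : ℚ) + 2 * ∑ j ∈ Finset.range c.J, |(c.Q (j + 1) : ℚ)| / (c.qden : ℚ)

/-- `0 ≤ absMassQ`. [cite: FitznerVanDerHofstad2016NoBLE, §5.1.1 (5.2)–(5.5) pp. 1089–1090] -/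
theorem absMassQ_nonneg : 0 ≤ c.absMassQ := by
  unfold absMassQ
  exact add_nonneg (div_nonneg (abs_nonneg _) (Nat.cast_nonneg _))
    (mul_nonneg zero_le_two (Finset.sum_nonneg fun j _ => div_nonneg (abs_nonneg _) (Nat.cast_nonneg _)))

/-- `‖c_j‖ = 2π |Q_j| / qden`. [cite: FitznerVanDerHofstad2016NoBLE, §5.1.1 (5.2)–(5.5) pp. 1089–1090] -/
theorem norm_cT (hq : 0 < c.qden) (j : ℕ) :
    ‖c.cT j‖ = 2 * π * (|((c.Q j : ℤ) : ℝ)| / (c.qden : ℝ)) := by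
  rw [TwCert.cT, norm_mul, norm_mul, norm_pow, Complex.norm_I, one_pow, mul_one, Complex.norm_real,
    Real.norm_eq_abs, abs_div, abs_of_pos (by exact_mod_cast hq : (0:ℝ) < (c.qden : ℝ))]
  have h2 : ‖(2 : ℂ) * π‖ = 2 * π := by
    rw [norm_mul, Complex.norm_real, Real.norm_eq_abs, abs_of_pos Real.pi_pos]
    simp
  rw [h2]

/-- `α' = Σ_j ε_j ‖c_j‖ = 2π · absMassQ`. [cite: FitznerVanDerHofstad2016NoBLE, §5.1.1 (5.2)–(5.5) pp. 1089–1090] -/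
theorem sum_weight_norm_cT (hq : 0 < c.qden) :
    ∑ j ∈ Finset.range (c.J + 1), (if j = 0 then (1 : ℝ) else 2) * ‖c.cT j‖
      = 2 * π * ((c.absMassQ : ℚ) : ℝ) := by
  simp_rw [c.norm_cT hq]
  rw [Finset.sum_range_succ', if_pos rfl, absMassQ]
  have hne : ∀ j : ℕ, (if j + 1 = 0 then (1 : ℝ) else 2) = 2 := fun j => if_neg (Nat.succ_ne_zero j)
  simp_rw [hne]
  push_cast
  have : ∑ j ∈ Finset.range c.J, (2 : ℝ) * (2 * π * (|((c.Q (j + 1) : ℤ) : ℝ)| / (c.qden : ℝ)))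
      = 2 * π * (2 * ∑ j ∈ Finset.range c.J, |((c.Q (j + 1) : ℤ) : ℝ)| / (c.qden : ℝ)) := by
    rw [Finset.mul_sum, Finset.mul_sum]
    exact Finset.sum_congr rfl fun j _ => by ring
  rw [this]
  ring

/-- **`truncErrT` from three scalars.** For `2(n+1)+1 ≤ D`, `0 < qden`: if the Bessel-`J` order tail is `≤ δ̄`,
every literal weight is within `e` of `J_j(β/D)` (`j ≤ J`), and all the plain seeds of the error term are `≤ I`,
then `truncErrT c D n β M ≤ (((1+2δ̄)^D − 1) + ((A + (2J+1)e)^D − A^D)) · I`, `A = absMassQ c`.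
[cite: FitznerVanDerHofstad2016NoBLE, §5.1.1 (5.2)–(5.5) pp. 1089–1090] -/
theorem truncErrT_le (n : ℕ) (hD : 2 * (n + 1) + 1 ≤ D) (hq : 0 < c.qden) (β : ℝ) (M : ℕ)
    {δb e I : ℝ}
    (hδ : ∑' l : ℕ, |besselJ (l + c.J + 1) (β / D)| ≤ δb)
    (he : ∀ j ∈ Finset.range (c.J + 1), |((c.Q j : ℤ) : ℝ) / (c.qden : ℝ) - besselJ j (β / D)| ≤ e)
    (hIk : ∀ k ∈ Finset.range D, srwI D (n + 1) 0
        (fun μ : Fin D => if (μ : ℕ) < k + 1 then ((((c.J + 1) * M : ℕ)) : ℤ) else 0) ≤ I)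
    (hI : srwI D (n + 1) 0 (fun _ : Fin D => 0) ≤ I) :
    c.truncErrT D n β M
      ≤ (((1 + 2 * δb) ^ D - 1)
          + ((((c.absMassQ : ℚ) : ℝ) + (2 * c.J + 1) * e) ^ D - ((c.absMassQ : ℚ) : ℝ) ^ D)) * I := by
  -- names
  set δ : ℝ := ∑' l : ℕ, |besselJ (l + c.J + 1) (β / D)| with hδdef
  set I₀ : ℝ := srwI D (n + 1) 0 (fun _ : Fin D => 0) with hI₀def
  set A : ℝ := ((c.absMassQ : ℚ) : ℝ) with hAdef
  set η : ℝ := ∑ j ∈ Finset.range (c.J + 1), (if j = 0 then (1 : ℝ) else 2)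
      * ‖2 * π * Complex.I ^ j * (besselJ j (β / D) : ℂ) - c.cT j‖ with hηdef
  have hδ0 : 0 ≤ δ := tsum_nonneg fun _ => abs_nonneg _
  have hδb0 : 0 ≤ δb := hδ0.trans hδ
  have hI₀0 : 0 ≤ I₀ := srwI_nonneg (d := D) (n + 1) hD 0 _
  have hI0 : 0 ≤ I := hI₀0.trans hI
  have hA0 : 0 ≤ A := by rw [hAdef]; exact_mod_cast c.absMassQ_nonneg
  have he0 : 0 ≤ e := (abs_nonneg _).trans (he 0 (by simp))
  have hw : ∀ j : ℕ, (0 : ℝ) ≤ (if j = 0 then (1 : ℝ) else 2) := fun j => by split_ifs <;> norm_num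
  have hη0 : 0 ≤ η := Finset.sum_nonneg fun j _ => mul_nonneg (hw j) (norm_nonneg _)
  have h2π : (0 : ℝ) < 2 * π := by positivity
  -- the first term
  have hT1 : (∑ k ∈ Finset.range D, (D.choose (k + 1) : ℝ) * (2 * δ) ^ (k + 1)
      * srwI D (n + 1) 0
          (fun μ : Fin D => if (μ : ℕ) < k + 1 then ((((c.J + 1) * M : ℕ)) : ℤ) else 0))
      ≤ ((1 + 2 * δb) ^ D - 1) * I := by
    calc (∑ k ∈ Finset.range D, (D.choose (k + 1) : ℝ) * (2 * δ) ^ (k + 1)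
          * srwI D (n + 1) 0
            (fun μ : Fin D => if (μ : ℕ) < k + 1 then ((((c.J + 1) * M : ℕ)) : ℤ) else 0))
        ≤ ∑ k ∈ Finset.range D, (D.choose (k + 1) : ℝ) * (2 * δb) ^ (k + 1) * I := by
          refine Finset.sum_le_sum fun k hk => ?_
          have h1 : (2 * δ) ^ (k + 1) ≤ (2 * δb) ^ (k + 1) :=
            pow_le_pow_left₀ (by positivity) (by linarith) _
          have h0 : 0 ≤ srwI D (n + 1) 0
              (fun μ : Fin D => if (μ : ℕ) < k + 1 then ((((c.J + 1) * M : ℕ)) : ℤ) else 0) :=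
            srwI_nonneg (d := D) (n + 1) hD 0 _
          exact mul_le_mul (mul_le_mul_of_nonneg_left h1 (Nat.cast_nonneg _)) (hIk k hk) h0
            (by positivity)
      _ = ((1 + 2 * δb) ^ D - 1) * I := by
          rw [← Finset.sum_mul, sum_choose_succ_mul_pow_succ]
  -- the second term
  have hα : ∑ j ∈ Finset.range (c.J + 1), (if j = 0 then (1 : ℝ) else 2) * ‖c.cT j‖ = 2 * π * A :=
    c.sum_weight_norm_cT hq
  have hη : η ≤ (2 * c.J + 1) * (2 * π * e) := by
    calc η ≤ ∑ j ∈ Finset.range (c.J + 1), (if j = 0 then (1 : ℝ) else 2) * (2 * π * e) := by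
          refine Finset.sum_le_sum fun j hj => mul_le_mul_of_nonneg_left ?_ (hw j)
          have h := Literature.Analysis.FunctionSpaces.JLit.norm_coeff_sub_coeff_le j (he j hj)
          simpa only [TwCert.cT] using h
      _ = (2 * c.J + 1) * (2 * π * e) := by rw [← Finset.sum_mul, sum_rowWeight_eq]
  have hT2 : ((∑ j ∈ Finset.range (c.J + 1), (if j = 0 then (1 : ℝ) else 2) * ‖c.cT j‖ + η) ^ D
        - (∑ j ∈ Finset.range (c.J + 1), (if j = 0 then (1 : ℝ) else 2) * ‖c.cT j‖) ^ D) / (2 * π) ^ D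
        * I₀ ≤ ((A + (2 * c.J + 1) * e) ^ D - A ^ D) * I := by
    rw [hα]
    have h1 : (2 * π * A + η) ^ D ≤ (2 * π * A + (2 * c.J + 1) * (2 * π * e)) ^ D :=
      pow_le_pow_left₀ (by positivity) (by linarith) D
    have h2 : (2 * π * A + (2 * c.J + 1) * (2 * π * e)) ^ D = (2 * π) ^ D * (A + (2 * c.J + 1) * e) ^ D := by
      rw [← mul_pow]; ring
    have h3 : (2 * π * A) ^ D = (2 * π) ^ D * A ^ D := mul_pow _ _ _
    have hnum : (2 * π * A + η) ^ D - (2 * π * A) ^ D ≤ ((A + (2 * c.J + 1) * e) ^ D - A ^ D) * (2 * π) ^ D := by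
      rw [sub_mul, mul_comm ((A + (2 * c.J + 1) * e) ^ D), mul_comm (A ^ D), ← h2, ← h3]
      linarith
    have hfrac : ((2 * π * A + η) ^ D - (2 * π * A) ^ D) / (2 * π) ^ D ≤ (A + (2 * c.J + 1) * e) ^ D - A ^ D :=
      (div_le_iff₀ (pow_pos h2π D)).2 hnum
    have hfrac0 : 0 ≤ ((2 * π * A + η) ^ D - (2 * π * A) ^ D) / (2 * π) ^ D :=
      div_nonneg (sub_nonneg.2 (pow_le_pow_left₀ (by positivity) (by linarith) D)) (pow_nonneg h2π.le D)
    exact mul_le_mul hfrac hI hI₀0 (hfrac0.trans hfrac)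
  -- assemble
  have key := add_le_add hT1 hT2
  calc c.truncErrT D n β M
      = (∑ k ∈ Finset.range D, (D.choose (k + 1) : ℝ) * (2 * δ) ^ (k + 1)
          * srwI D (n + 1) 0
            (fun μ : Fin D => if (μ : ℕ) < k + 1 then ((((c.J + 1) * M : ℕ)) : ℤ) else 0))
        + ((∑ j ∈ Finset.range (c.J + 1), (if j = 0 then (1 : ℝ) else 2) * ‖c.cT j‖ + η) ^ D
            - (∑ j ∈ Finset.range (c.J + 1), (if j = 0 then (1 : ℝ) else 2) * ‖c.cT j‖) ^ D) / (2 * π) ^ D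
          * I₀ := by
        rw [truncErrT]
    _ ≤ ((1 + 2 * δb) ^ D - 1) * I + ((A + (2 * c.J + 1) * e) ^ D - A ^ D) * I := key
    _ = (((1 + 2 * δb) ^ D - 1) + ((A + (2 * c.J + 1) * e) ^ D - A ^ D)) * I := by ring

/-- **The case `M = 0`** (all error seeds at the origin): one seed bound `I_{n+1,0}(0) ≤ I` suffices.
[cite: FitznerVanDerHofstad2016NoBLE, §5.1.1 (5.2)–(5.5) pp. 1089–1090] -/
theorem truncErrT_zero_le (n : ℕ) (hD : 2 * (n + 1) + 1 ≤ D) (hq : 0 < c.qden) (β : ℝ)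
    {δb e I : ℝ}
    (hδ : ∑' l : ℕ, |besselJ (l + c.J + 1) (β / D)| ≤ δb)
    (he : ∀ j ∈ Finset.range (c.J + 1), |((c.Q j : ℤ) : ℝ) / (c.qden : ℝ) - besselJ j (β / D)| ≤ e)
    (hI : srwI D (n + 1) 0 (fun _ : Fin D => 0) ≤ I) :
    c.truncErrT D n β 0
      ≤ (((1 + 2 * δb) ^ D - 1)
          + ((((c.absMassQ : ℚ) : ℝ) + (2 * c.J + 1) * e) ^ D - ((c.absMassQ : ℚ) : ℝ) ^ D)) * I := by
  refine c.truncErrT_le D n hD hq β 0 hδ he (fun k _ => ?_) hI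
  have hfun : (fun μ : Fin D => if (μ : ℕ) < k + 1 then ((((c.J + 1) * 0 : ℕ)) : ℤ) else 0)
      = fun _ : Fin D => 0 := by
    funext μ; simp
  rw [hfun]; exact hI

/-- The three-scalar bound as a RATIONAL function of rational inputs:
`truncErrQ c D δ̄ e I = (((1+2δ̄)^D − 1) + ((A + (2J+1)e)^D − A^D)) · I`, `A = absMassQ c`.
[cite: FitznerVanDerHofstad2016NoBLE, §5.1.1 (5.2)–(5.5) pp. 1089–1090] -/
def truncErrQ (δb e I : ℚ) : ℚ :=
  (((1 + 2 * δb) ^ D - 1) + ((c.absMassQ + (2 * c.J + 1) * e) ^ D - c.absMassQ ^ D)) * I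

/-- Cast of `truncErrQ`. [cite: FitznerVanDerHofstad2016NoBLE, §5.1.1 (5.2)–(5.5) pp. 1089–1090] -/
theorem cast_truncErrQ (δb e I : ℚ) :
    ((c.truncErrQ D δb e I : ℚ) : ℝ)
      = (((1 + 2 * (δb : ℝ)) ^ D - 1)
          + ((((c.absMassQ : ℚ) : ℝ) + (2 * c.J + 1) * (e : ℝ)) ^ D - ((c.absMassQ : ℚ) : ℝ) ^ D)) * (I : ℝ) := by
  rw [truncErrQ]; push_cast; ring

/-- **`M = 0`, rational inputs:** `truncErrT c D n β 0 ≤ ((truncErrQ c D δ̄ e I : ℚ) : ℝ)` — the shape consumed by a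
kernel-decided literal inequality. [cite: FitznerVanDerHofstad2016NoBLE, §5.1.1 (5.2)–(5.5) pp. 1089–1090] -/
theorem truncErrT_zero_le_cast (n : ℕ) (hD : 2 * (n + 1) + 1 ≤ D) (hq : 0 < c.qden) (β : ℝ)
    {δb e I : ℚ}
    (hδ : ∑' l : ℕ, |besselJ (l + c.J + 1) (β / D)| ≤ (δb : ℝ))
    (he : ∀ j ∈ Finset.range (c.J + 1), |((c.Q j : ℤ) : ℝ) / (c.qden : ℝ) - besselJ j (β / D)| ≤ (e : ℝ))
    (hI : srwI D (n + 1) 0 (fun _ : Fin D => 0) ≤ (I : ℝ)) :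
    c.truncErrT D n β 0 ≤ ((c.truncErrQ D δb e I : ℚ) : ℝ) := by
  rw [cast_truncErrQ]
  exact c.truncErrT_zero_le D n hD hq β hδ he hI

end TwCert

end Literature.Probability.FitznerVanDerHofstad2017.SeedCert
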